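import Summits.QuantumFields.YangMills.Theorems.ColdStartUniversalityLatticeLangevinGeneratorSymmetric
import HarnessLib

/-!
# Route `ColdStartUniversality` (fixed-cut-off package): two more pieces of generator calculus for the SU(2) SZZ dynamics —
# the WEIGHTED Dynkin slope `τ⁻¹(∫ H·κ_τF dμ − ∫ H·F dμ) → ∫ H·𝓛f dμ` and the BILINEAR energy identity `−2∫ A·𝓛b dμ = ∫ Γ(a,b) dμ`

Helper file (seat `ym-line-csu-p1`, g22; `--supports stmt-QuantumFields-27363`), sequel of `…GeneratorSymmetric` (g17: the case `H = F`,
`a = b`).  For the Wilson measure `μ = μ_{β'}` on `SU(2)^E`, any Markov kernel family `κ` realising the SZZ transition laws, a `C³`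
compactly supported `f` of the real link coordinates (`F = f∘coords`, `𝓛f` its coordinate generator):

* ★ `tendsto_weighted_transition_slope` — for every CONTINUOUS weight `H`: `τ⁻¹ (∫ H·κ_τF dμ − ∫ H·F dμ) → ∫ H·𝓛f dμ` as `τ ↓ 0`
  (Dynkin `κ_τF(x) = F(x) + ∫₀^τ κ_r(𝓛f)(x) dr`, Fubini, FTC at `0⁺`);
* ★ `two_mul_integral_mul_generator_bilin_eq_neg_carre` — for `C³` compactly supported `a, b`:
  `2 ∫ (a∘coords)·𝓛b dμ = −∫ Γ(a,b)∘coords dμ`, `Γ(a,b) = Σ_{ij} ∂_i a ∂_j b (σσᵀ)_{ij}` (Leibniz `𝓛(ab) = a𝓛b + b𝓛a + Γ(a,b)`,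
  infinitesimal invariance `∫ 𝓛(ab) dμ = 0`, symmetry `∫ A𝓛b = ∫ B𝓛a`).

Both are used next door for the converse «exponential entropy decay ⇒ log-Sobolev» (BGL Thm 5.2.1 (ii)⇒(i)).  THEOREMS ONLY, no
definition, no sorry.  RECORD-rung R3 plumbing at fixed cut-off; nothing here bears on the Yang–Mills mass gap.
-/

set_option autoImplicit false

noncomputable section

namespace Summit.QuantumFields.YangMills.Theorems.ColdStartUniversality

open MeasureTheory ProbabilityTheory Finset Filter Set Topology intervalIntegral
open scoped BigOperators NNReal ENNReal
open Literature.Probability.Process Literature.MathematicalPhysics.QuantumFieldTheory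
open Literature.MathematicalPhysics.QuantumLattice (fundamentalRep fundamentalLatticeRep continuous_fundamentalRep)

variable {L : ℕ} [NeZero L]

/-! ## §1. The weighted Dynkin slope -/

/-- ★ **Weighted Dynkin slope**: for a `C³` compactly supported `f` (`F = f∘coords`), any realising kernel family `κ` and any CONTINUOUS
weight `H` on `SU(2)^E`, `τ⁻¹ (∫ H · κ_τ F dμ_{β'} − ∫ H · F dμ_{β'}) → ∫ H · 𝓛f dμ_{β'}` as `τ ↓ 0` (the case `H = F` is
`tendsto_dirichletForm_semigroup`). [cite: ShenZhuZhu2022, §3 (p. 13)] -/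
theorem tendsto_weighted_transition_slope (L : ℕ) [NeZero L] (β' : ℝ)
    (κ : ℝ≥0 → Kernel (GaugeConfig 3 L (Matrix.specialUnitaryGroup (Fin 2) ℂ))
      (GaugeConfig 3 L (Matrix.specialUnitaryGroup (Fin 2) ℂ))) [∀ t, IsMarkovKernel (κ t)]
    (hreal : ∀ (t : ℝ≥0) (x : GaugeConfig 3 L (Matrix.specialUnitaryGroup (Fin 2) ℂ))
        (Ω : Type) [MeasurableSpace Ω] (P : Measure Ω) [IsProbabilityMeasure P]
        (W : ℝ≥0 → Ω → (Edge 3 L × NoiseIdx 2 → ℝ)) (hW : IsFlatBrownian W P)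
        (U : ℝ≥0 → Ω → GaugeConfig 3 L (Matrix.specialUnitaryGroup (Fin 2) ℂ)),
        (∀ ω, U 0 ω = x) →
        (latticeLangevinDynamics (fundamentalLatticeRep 2) β').IsSolution (fundamentalRep (Fin 2))
          hW.natFiltration P W U →
        κ t x = P.map (U t))
    {f : (Edge 3 L × Fin 2 × Fin 2 × Bool → ℝ) → ℝ} (hf : ContDiff ℝ 3 f) (hfc : HasCompactSupport f)
    {H : GaugeConfig 3 L (Matrix.specialUnitaryGroup (Fin 2) ℂ) → ℝ} (hH : Continuous H) :
    let coords : GaugeConfig 3 L (Matrix.specialUnitaryGroup (Fin 2) ℂ) → (Edge 3 L × Fin 2 × Fin 2 × Bool → ℝ) :=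
      fun V q => (fun z : ℂ => if q.2.2.2 then z.im else z.re)
        ((fundamentalRep (Fin 2) (V q.1) : Matrix (Fin 2) (Fin 2) ℂ) q.2.1 q.2.2.1)
    let gen : GaugeConfig 3 L (Matrix.specialUnitaryGroup (Fin 2) ℂ) → ℝ := fun V =>
      (∑ i : Edge 3 L × Fin 2 × Fin 2 × Bool, fderiv ℝ f (coords V) (Pi.single i 1) *
          (fun z : ℂ => if i.2.2.2 then z.im else z.re)
            ((latticeLangevinDynamics (fundamentalLatticeRep 2) β').drift
              (matrixConfig (fundamentalRep (Fin 2)) V) i.1 i.2.1 i.2.2.1) +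
      1 / 2 * ∑ i : Edge 3 L × Fin 2 × Fin 2 × Bool, ∑ j : Edge 3 L × Fin 2 × Fin 2 × Bool,
        fderiv ℝ (fun z => fderiv ℝ f z (Pi.single i 1)) (coords V) (Pi.single j 1) *
          ∑ n : Edge 3 L × NoiseIdx 2,
            (if n.1 = i.1 then (fun z : ℂ => if i.2.2.2 then z.im else z.re)
              ((latticeLangevinDynamics (fundamentalLatticeRep 2) β').noise
                (matrixConfig (fundamentalRep (Fin 2)) V) i.1 n.2 i.2.1 i.2.2.1) else 0) *
            (if n.1 = j.1 then (fun z : ℂ => if j.2.2.2 then z.im else z.re)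
              ((latticeLangevinDynamics (fundamentalLatticeRep 2) β').noise
                (matrixConfig (fundamentalRep (Fin 2)) V) j.1 n.2 j.2.1 j.2.2.1) else 0))
    Tendsto (fun τ : ℝ => τ⁻¹ * ((∫ V, H V * (∫ y, f (coords y) ∂(κ τ.toNNReal V))
        ∂(wilsonMeasure (d := 3) (L := L) (fundamentalRep (Fin 2)) β')) -
        ∫ V, H V * f (coords V) ∂(wilsonMeasure (d := 3) (L := L) (fundamentalRep (Fin 2)) β')))
      (𝓝[>] 0) (𝓝 (∫ V, H V * gen V ∂(wilsonMeasure (d := 3) (L := L) (fundamentalRep (Fin 2)) β'))) := by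
  intro coords gen
  classical
  haveI := secondCountableTopology_su2
  haveI := borelSpace_config L
  set μ : Measure (GaugeConfig 3 L (Matrix.specialUnitaryGroup (Fin 2) ℂ)) :=
    wilsonMeasure (d := 3) (L := L) (fundamentalRep (Fin 2)) β' with hμ
  haveI : IsProbabilityMeasure μ :=
    isProbabilityMeasure_wilsonMeasure (d := 3) (L := L) (fundamentalRep (Fin 2)) (continuous_fundamentalRep (Fin 2)) β'
  have hco : Continuous coords := continuous_coords (L := L)
  have hFc : Continuous fun V => f (coords V) := hf.continuous.comp hco
  have hgf : Continuous gen := continuous_generator (L := L) β' (hf.of_le (by norm_num))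
  have hDf : ∀ x, ∀ {τ : ℝ}, 0 ≤ τ →
      ∫ y, f (coords y) ∂(κ τ.toNNReal x) = f (coords x) + ∫ r in (0 : ℝ)..τ, (∫ y, gen y ∂(κ r.toNNReal x)) :=
    fun x τ hτ => transitionKernel_dynkin (L := L) β' κ hreal hf hfc x hτ
  have hJ : Continuous (Function.uncurry fun (r : ℝ) (x : GaugeConfig 3 L (Matrix.specialUnitaryGroup (Fin 2) ℂ)) =>
      H x * ∫ y, gen y ∂(κ r.toNNReal x)) :=
    (hH.comp continuous_snd).mul ((continuous_transitionKernel_action β' κ hreal hgf).comp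
      ((continuous_real_toNNReal.comp continuous_fst).prodMk continuous_snd))
  set φ : ℝ → ℝ := fun r => ∫ x, H x * ∫ y, gen y ∂(κ r.toNNReal x) ∂μ with hφ
  have hφc : Continuous φ := continuous_integral_of_continuous_uncurry μ hJ
  -- `∫ H κ_τ F dμ - ∫ H F dμ = ∫₀^τ φ` for `τ > 0`
  have hkey : ∀ τ : ℝ, 0 < τ → (∫ V, H V * (∫ y, f (coords y) ∂(κ τ.toNNReal V)) ∂μ) -
      ∫ V, H V * f (coords V) ∂μ = ∫ r in (0 : ℝ)..τ, φ r := by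
    intro τ hτ
    have hI : Continuous fun x : GaugeConfig 3 L (Matrix.specialUnitaryGroup (Fin 2) ℂ) =>
        ∫ r in (0 : ℝ)..τ, H x * ∫ y, gen y ∂(κ r.toNNReal x) := by
      have h' : Continuous (Function.uncurry fun (x : GaugeConfig 3 L (Matrix.specialUnitaryGroup (Fin 2) ℂ)) (r : ℝ) =>
          H x * ∫ y, gen y ∂(κ r.toNNReal x)) := hJ.comp continuous_swap
      exact intervalIntegral.continuous_parametric_intervalIntegral_of_continuous' h' 0 τ
    have hpt : ∀ x, H x * (∫ y, f (coords y) ∂(κ τ.toNNReal x)) =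
        H x * f (coords x) + ∫ r in (0 : ℝ)..τ, H x * ∫ y, gen y ∂(κ r.toNNReal x) := by
      intro x; rw [hDf x hτ.le, mul_add, intervalIntegral.integral_const_mul]
    rw [integral_congr_ae (Eventually.of_forall hpt), integral_add (integrable_of_continuous_of_compactSpace
      (f := fun V => H V * f (coords V)) (hH.mul hFc) μ)
      (integrable_of_continuous_of_compactSpace hI μ), integral_intervalIntegral_swap_of_continuous μ hJ hτ.le]
    ring
  have hlim := tendsto_inv_mul_intervalIntegral_of_continuous hφc
  have hφ0 : φ 0 = ∫ V, H V * gen V ∂μ := by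
    refine integral_congr_ae (Eventually.of_forall fun x => ?_)
    have hx : ∫ y, gen y ∂(κ (0 : ℝ).toNNReal x) = gen x := by
      have hsol : κ (0 : ℝ).toNNReal x = Measure.dirac x := by
        haveI := isProbabilityMeasure_piWiener (Edge 3 L × NoiseIdx 2)
        have hWc := isFlatBrownian_piWiener 3 L (NoiseIdx 2)
        obtain ⟨U, hU0, hU⟩ := solution_from_start hWc β' x
        rw [Real.toNNReal_zero, hreal 0 x _ _ _ hWc U hU0 hU]
        have hU0' : U 0 = fun _ => x := funext hU0
        rw [hU0', Measure.map_const, measure_univ, one_smul]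
      rw [hsol, integral_dirac]
    simp only [hx]
  rw [← hφ0]
  refine hlim.congr' ?_
  filter_upwards [self_mem_nhdsWithin] with τ hτ
  rw [hkey τ hτ]

/-! ## §2. The bilinear energy identity -/

/-- ★ **Bilinear energy identity**: for `C³` compactly supported `a, b` of the real link coordinates,
`2 ∫ (a∘coords) · 𝓛b dμ_{β'} = −∫ Γ(a,b)∘coords dμ_{β'}` with `Γ(a,b) = Σ_{ij} ∂_i a ∂_j b Σ_n σ_{in} σ_{jn}` — Leibniz
`𝓛(ab) = a𝓛b + b𝓛a + Γ(a,b)`, `∫ 𝓛(ab) dμ = 0`, and the symmetry `∫ A·𝓛b dμ = ∫ B·𝓛a dμ`. [cite: ShenZhuZhu2022, §3 (p. 13)] -/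
theorem two_mul_integral_mul_generator_bilin_eq_neg_carre (L : ℕ) [NeZero L] (β' : ℝ)
    {a b : (Edge 3 L × Fin 2 × Fin 2 × Bool → ℝ) → ℝ} (ha : ContDiff ℝ 3 a) (hac : HasCompactSupport a)
    (hb : ContDiff ℝ 3 b) (hbc : HasCompactSupport b) :
    let coords : GaugeConfig 3 L (Matrix.specialUnitaryGroup (Fin 2) ℂ) → (Edge 3 L × Fin 2 × Fin 2 × Bool → ℝ) :=
      fun V q => (fun z : ℂ => if q.2.2.2 then z.im else z.re)
        ((fundamentalRep (Fin 2) (V q.1) : Matrix (Fin 2) (Fin 2) ℂ) q.2.1 q.2.2.1)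
    let bb : GaugeConfig 3 L (Matrix.specialUnitaryGroup (Fin 2) ℂ) → (Edge 3 L × Fin 2 × Fin 2 × Bool) → ℝ := fun V i =>
      (fun z : ℂ => if i.2.2.2 then z.im else z.re)
        ((latticeLangevinDynamics (fundamentalLatticeRep 2) β').drift (matrixConfig (fundamentalRep (Fin 2)) V) i.1 i.2.1 i.2.2.1)
    let A : GaugeConfig 3 L (Matrix.specialUnitaryGroup (Fin 2) ℂ) → (Edge 3 L × Fin 2 × Fin 2 × Bool) →
        (Edge 3 L × Fin 2 × Fin 2 × Bool) → ℝ := fun V i j =>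
      ∑ n : Edge 3 L × NoiseIdx 2,
        (if n.1 = i.1 then (fun z : ℂ => if i.2.2.2 then z.im else z.re)
          ((latticeLangevinDynamics (fundamentalLatticeRep 2) β').noise
            (matrixConfig (fundamentalRep (Fin 2)) V) i.1 n.2 i.2.1 i.2.2.1) else 0) *
        (if n.1 = j.1 then (fun z : ℂ => if j.2.2.2 then z.im else z.re)
          ((latticeLangevinDynamics (fundamentalLatticeRep 2) β').noise
            (matrixConfig (fundamentalRep (Fin 2)) V) j.1 n.2 j.2.1 j.2.2.1) else 0)
    let gen : ((Edge 3 L × Fin 2 × Fin 2 × Bool → ℝ) → ℝ) → GaugeConfig 3 L (Matrix.specialUnitaryGroup (Fin 2) ℂ) → ℝ :=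
      fun h V =>
      (∑ i : Edge 3 L × Fin 2 × Fin 2 × Bool, fderiv ℝ h (coords V) (Pi.single i 1) * bb V i +
      1 / 2 * ∑ i : Edge 3 L × Fin 2 × Fin 2 × Bool, ∑ j : Edge 3 L × Fin 2 × Fin 2 × Bool,
        fderiv ℝ (fun z => fderiv ℝ h z (Pi.single i 1)) (coords V) (Pi.single j 1) * A V i j)
    2 * ∫ V, a (coords V) * gen b V ∂(wilsonMeasure (d := 3) (L := L) (fundamentalRep (Fin 2)) β') =
      -∫ V, (∑ i : Edge 3 L × Fin 2 × Fin 2 × Bool, ∑ j : Edge 3 L × Fin 2 × Fin 2 × Bool,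
        fderiv ℝ a (coords V) (Pi.single i 1) * fderiv ℝ b (coords V) (Pi.single j 1) * A V i j)
        ∂(wilsonMeasure (d := 3) (L := L) (fundamentalRep (Fin 2)) β') := by
  intro coords bb A gen
  classical
  haveI := secondCountableTopology_su2
  haveI := borelSpace_config L
  set μ : Measure (GaugeConfig 3 L (Matrix.specialUnitaryGroup (Fin 2) ℂ)) :=
    wilsonMeasure (d := 3) (L := L) (fundamentalRep (Fin 2)) β' with hμ
  haveI : IsProbabilityMeasure μ :=
    isProbabilityMeasure_wilsonMeasure (d := 3) (L := L) (fundamentalRep (Fin 2)) (continuous_fundamentalRep (Fin 2)) β'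
  have hco : Continuous coords := continuous_coords (L := L)
  have hAc : Continuous fun V => a (coords V) := ha.continuous.comp hco
  have hBc : Continuous fun V => b (coords V) := hb.continuous.comp hco
  have hga : Continuous (gen a) := continuous_generator (L := L) β' (ha.of_le (by norm_num))
  have hgb : Continuous (gen b) := continuous_generator (L := L) β' (hb.of_le (by norm_num))
  have hab : ContDiff ℝ 3 (fun z => a z * b z) := ha.mul hb
  have habc : HasCompactSupport (fun z => a z * b z) := hbc.mul_left
  have hinv : ∫ V, gen (fun z => a z * b z) V ∂μ = 0 := integral_generator_wilson_eq_zero L β' hab habc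
  have hgab : Continuous (gen fun z => a z * b z) := continuous_generator (L := L) β' (hab.of_le (by norm_num))
  have hsymm : ∫ V, a (coords V) * gen b V ∂μ = ∫ V, b (coords V) * gen a V ∂μ :=
    integral_mul_generator_symm L β' hb hbc ha hac
  -- Leibniz pointwise
  have hA : ∀ V i j, A V i j = A V j i := fun V i j => Finset.sum_congr rfl fun n _ => mul_comm _ _
  have hleib : ∀ V, gen (fun z => a z * b z) V = a (coords V) * gen b V + b (coords V) * gen a V +
      ∑ i, ∑ j, fderiv ℝ a (coords V) (Pi.single i 1) * fderiv ℝ b (coords V) (Pi.single j 1) * A V i j := by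
    intro V
    exact generator_mul (fun i : Edge 3 L × Fin 2 × Fin 2 × Bool => (Pi.single i (1 : ℝ) : _ → ℝ)) (bb V) (A V) (hA V)
      (ha.of_le (by norm_num)) (hb.of_le (by norm_num)) (coords V)
  have hΓc : Continuous fun V => ∑ i, ∑ j, fderiv ℝ a (coords V) (Pi.single i 1) * fderiv ℝ b (coords V) (Pi.single j 1) * A V i j := by
    have h : (fun V => ∑ i, ∑ j, fderiv ℝ a (coords V) (Pi.single i 1) * fderiv ℝ b (coords V) (Pi.single j 1) * A V i j) =
        fun V => gen (fun z => a z * b z) V - (a (coords V) * gen b V + b (coords V) * gen a V) := by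
      funext V; rw [hleib V]; ring
    rw [h]
    exact hgab.sub ((hAc.mul hgb).add (hBc.mul hga))
  have e : ∫ V, gen (fun z => a z * b z) V ∂μ =
      (∫ V, a (coords V) * gen b V ∂μ) + (∫ V, b (coords V) * gen a V ∂μ) +
        ∫ V, (∑ i, ∑ j, fderiv ℝ a (coords V) (Pi.single i 1) * fderiv ℝ b (coords V) (Pi.single j 1) * A V i j) ∂μ := by
    have i1 : Integrable (fun V => a (coords V) * gen b V) μ := integrable_of_continuous_of_compactSpace (hAc.mul hgb) μ
    have i2 : Integrable (fun V => b (coords V) * gen a V) μ := integrable_of_continuous_of_compactSpace (hBc.mul hga) μ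
    have i12 : Integrable (fun V => a (coords V) * gen b V + b (coords V) * gen a V) μ := i1.add i2
    have i3 : Integrable (fun V => ∑ i, ∑ j, fderiv ℝ a (coords V) (Pi.single i 1) * fderiv ℝ b (coords V) (Pi.single j 1) *
        A V i j) μ := integrable_of_continuous_of_compactSpace hΓc μ
    rw [integral_congr_ae (Eventually.of_forall hleib), integral_add i12 i3, integral_add i1 i2]
  rw [hinv, ← hsymm] at e
  linarith

end Summit.QuantumFields.YangMills.Theorems.ColdStartUniversality

end
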